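import Literature.NumberTheory.ModularForms.BinaryQuadGaussSumLattice
import Mathlib.NumberTheory.LegendreSymbol.AddCharacter
import HarnessLib

/-!
# Gauss sums of binary quadratic forms, IV: Parseval over the twists, and the untwisted modulus
# as a kernel count

Topic `NumberTheory/ModularForms` (namespace `Literature.NumberTheory.ModularForms`), continuing the
series `BinaryQuadGaussSum*.lean` (`binQuadGaussSum c f a w₁ w₂ = G(a, c; f, w) =
∑_{v mod c} e((a f(v) + w·v)/c)`, `f = (A,B,C)`, Gram matrix `M = (2A B; B 2C)`,
`M·adj M = (4AC − B²)·1`). Everything here is PROVED; no definition, no named fact. These are the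
two global identities from which the modulus `|G(a, c; f, 0)| = c·√(c, D)` follows for EVERY `c`
(even or odd, no condition `(A, c) = 1`; sequel `BinaryQuadGaussSumNorm.lean`), complementing the
odd-`c` evaluation via one-variable Gauss sums in `BinaryQuadGaussSumValues.lean`:

* `sum_norm_sq_binQuadGaussSum` — **Parseval over the twists**:
  `Σ_{w ∈ (ℤ/c)²} |G(a, c; f, w)|² = c⁴` for every `a` (orthogonality of the characters
  `v ↦ e(w·v/c)` of `(ℤ/c)²`; `G(a,c;f,·)` is the Fourier transform of `v ↦ e(a f(v)/c)`, a
  function of modulus one).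
* `eval_eq_zero_of_gram_eq_zero` — if `D = B² − 4AC` is odd and `M h = 0` in `(ℤ/c)²` then
  `f(h) = 0` in `ℤ/c` (`2f(h) = hᵀMh = 0` and `D²f(h) = f(adj(M)Mh) = 0`, and `(D², 2) = 1`).
* `norm_sq_binQuadGaussSum_zero_zero_eq_card` — **the untwisted modulus as a kernel count**: for
  `a` a unit and `D` odd, `|G(a, c; f, 0)|² = c² · #{h ∈ (ℤ/c)² : M h = 0}`
  (`|G|² = Σ_{v,v'} e(a(f(v) − f(v'))/c)`, `v = v' + h`, `f(v'+h) − f(v') = hᵀMv' + f(h)`, and the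
  sum over `v'` detects `a·Mh = 0`).
* `card_gram_ker_eq_card_adj_ker` — `#{h : M h = 0} = #{k : adj(M) k = 0}` in `(ℤ/n)²`
  (`k ↦ (k₂, −k₁)`).

## References

* A. N. Andrianov, V. G. Zhuravlev, *Modular Forms and Hecke Operators*, AMS (1995/2015), Ch. 1
  §4.3–4.4 (Gauss sums of quadratic forms, (4.10)–(4.14), Proposition 4.9) [AndrianovZhuravlev2015].
* B. Conrey, H. Iwaniec, Acta Arith. 103 (2002) 259–312, §3 (3.15)–(3.17): `|η| = 1` for the
  pseudo-eigenvalue at a cusp with `(c, q) = s` [ConreyIwaniec2002].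
-/

noncomputable section

open Complex Finset

namespace Literature.NumberTheory.ModularForms

open Literature.NumberTheory.QuadraticFields.Quadratic (BinQF)
open Literature.NumberTheory.LFunctions (norm_stdAddChar)

variable {c : ℕ} [NeZero c]

/-! ### Characters of `(ℤ/c)²` -/

/-- `conj e(j/c) = e(−j/c)`. [folklore] -/
private theorem conj_stdAddChar (j : ZMod c) :
    (starRingEnd ℂ) (ZMod.stdAddChar j : ℂ) = (ZMod.stdAddChar (-j) : ℂ) := by
  rw [ZMod.stdAddChar_apply, ZMod.stdAddChar_apply, ← Circle.coe_inv_eq_conj,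
    AddChar.map_neg_eq_inv]

/-- Orthogonality on `(ℤ/c)²`: `Σ_{w} e((w₁d₁ + w₂d₂)/c) = c²·[d = 0]`.
[cite: AndrianovZhuravlev2015, Ch. 1 §4.3 (4.10)–(4.12)] -/
theorem sum_stdAddChar_linear (d₁ d₂ : ZMod c) :
    ∑ w : ZMod c × ZMod c, (ZMod.stdAddChar (w.1 * d₁ + w.2 * d₂) : ℂ) =
      if d₁ = 0 ∧ d₂ = 0 then ((c : ℂ) ^ 2) else 0 := by
  classical
  have hprim := ZMod.isPrimitive_stdAddChar c
  rw [Fintype.sum_prod_type]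
  simp_rw [AddChar.map_add_eq_mul, ← Finset.mul_sum, ← Finset.sum_mul,
    AddChar.sum_mulShift d₁ hprim, AddChar.sum_mulShift d₂ hprim, ZMod.card]
  split_ifs with h1 h2 h3 <;> simp_all [sq]

/-! ### Parseval over the twists -/

/-- **Parseval over the twists.** For every numerator `a` and form `f`:
`Σ_{w ∈ (ℤ/c)²} |G(a, c; f, w)|² = c⁴` — the sums `G(a,c;f,w)`, `w ∈ (ℤ/c)²`, are the Fourier
coefficients of the unimodular function `v ↦ e(a f(v)/c)` on `(ℤ/c)²`. (The "`c⁻²G`" normalisation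
of loc. cit. (4.10) makes this `Σ_w |c⁻²G|² = 1`.) [cite: AndrianovZhuravlev2015, Ch. 1 §4.3 (4.10)–(4.14)] -/
theorem sum_norm_sq_binQuadGaussSum (f : BinQF) (a : ZMod c) :
    ∑ w : ZMod c × ZMod c, ‖binQuadGaussSum c f a w.1 w.2‖ ^ 2 = (c : ℝ) ^ 4 := by
  classical
  -- work in `ℂ`
  have key : ∀ w : ZMod c × ZMod c, ((‖binQuadGaussSum c f a w.1 w.2‖ : ℂ) ^ 2) =
      ∑ v : ZMod c × ZMod c, ∑ v' : ZMod c × ZMod c,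
        (ZMod.stdAddChar (a * ((f.a : ZMod c) * v.1 ^ 2 + (f.b : ZMod c) * v.1 * v.2 +
            (f.c : ZMod c) * v.2 ^ 2) -
          a * ((f.a : ZMod c) * v'.1 ^ 2 + (f.b : ZMod c) * v'.1 * v'.2 +
            (f.c : ZMod c) * v'.2 ^ 2)) : ℂ) *
        (ZMod.stdAddChar (w.1 * (v.1 - v'.1) + w.2 * (v.2 - v'.2)) : ℂ) := by
    intro w
    rw [← Complex.mul_conj', binQuadGaussSum_def, map_sum, Finset.sum_mul_sum]
    refine Finset.sum_congr rfl fun v _ ↦ Finset.sum_congr rfl fun v' _ ↦ ?_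
    rw [conj_stdAddChar, ← AddChar.map_add_eq_mul, ← AddChar.map_add_eq_mul]
    congr 1
    ring
  apply Complex.ofReal_injective
  push_cast
  simp_rw [key]
  rw [Finset.sum_comm]
  have h3 : ∀ v : ZMod c × ZMod c,
      ∑ w : ZMod c × ZMod c, ∑ v' : ZMod c × ZMod c,
        (ZMod.stdAddChar (a * ((f.a : ZMod c) * v.1 ^ 2 + (f.b : ZMod c) * v.1 * v.2 +
            (f.c : ZMod c) * v.2 ^ 2) -
          a * ((f.a : ZMod c) * v'.1 ^ 2 + (f.b : ZMod c) * v'.1 * v'.2 +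
            (f.c : ZMod c) * v'.2 ^ 2)) : ℂ) *
        (ZMod.stdAddChar (w.1 * (v.1 - v'.1) + w.2 * (v.2 - v'.2)) : ℂ) =
      ∑ v' : ZMod c × ZMod c,
        (ZMod.stdAddChar (a * ((f.a : ZMod c) * v.1 ^ 2 + (f.b : ZMod c) * v.1 * v.2 +
            (f.c : ZMod c) * v.2 ^ 2) -
          a * ((f.a : ZMod c) * v'.1 ^ 2 + (f.b : ZMod c) * v'.1 * v'.2 +
            (f.c : ZMod c) * v'.2 ^ 2)) : ℂ) *
        (if v.1 - v'.1 = 0 ∧ v.2 - v'.2 = 0 then ((c : ℂ) ^ 2) else 0) := by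
    intro v
    rw [Finset.sum_comm]
    refine Finset.sum_congr rfl fun v' _ ↦ ?_
    rw [← Finset.mul_sum, sum_stdAddChar_linear]
  rw [Finset.sum_congr rfl fun v _ ↦ h3 v]
  -- only `v' = v` survives
  have hv : ∀ v : ZMod c × ZMod c,
      ∑ v' : ZMod c × ZMod c,
        (ZMod.stdAddChar (a * ((f.a : ZMod c) * v.1 ^ 2 + (f.b : ZMod c) * v.1 * v.2 +
            (f.c : ZMod c) * v.2 ^ 2) -
          a * ((f.a : ZMod c) * v'.1 ^ 2 + (f.b : ZMod c) * v'.1 * v'.2 +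
            (f.c : ZMod c) * v'.2 ^ 2)) : ℂ) *
        (if v.1 - v'.1 = 0 ∧ v.2 - v'.2 = 0 then ((c : ℂ) ^ 2) else 0) = (c : ℂ) ^ 2 := by
    intro v
    rw [Finset.sum_eq_single v]
    · simp [AddChar.map_zero_eq_one]
    · intro v' _ hne
      have : ¬ (v.1 - v'.1 = 0 ∧ v.2 - v'.2 = 0) := by
        rintro ⟨h1, h2⟩
        exact hne (Prod.ext (sub_eq_zero.mp h1).symm (sub_eq_zero.mp h2).symm)
      rw [if_neg this, mul_zero]
    · intro h; exact absurd (Finset.mem_univ v) h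
  simp_rw [hv]
  rw [Finset.sum_const, Finset.card_univ, Fintype.card_prod, ZMod.card, nsmul_eq_mul]
  push_cast
  ring

/-! ### The untwisted modulus as a kernel count -/

omit [NeZero c] in
/-- On the kernel of the Gram matrix the form vanishes mod `c` (odd discriminant): if
`2A h₁ + B h₂ = 0` and `B h₁ + 2C h₂ = 0` in `ℤ/c` and `D = B² − 4AC` is odd, then
`A h₁² + B h₁h₂ + C h₂² = 0` in `ℤ/c`. Indeed `2 f(h) = hᵀ M h = 0`, `D h = −adj(M) M h = 0` so
`D² f(h) = f(D h) = 0`, and `u D² + 2 v = 1` for some `u, v`. [cite: ConreyIwaniec2002, §3 (3.16)–(3.17)] -/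
theorem eval_eq_zero_of_gram_eq_zero (f : BinQF) (hodd : Odd f.disc) (h₁ h₂ : ZMod c)
    (hM1 : 2 * (f.a : ZMod c) * h₁ + (f.b : ZMod c) * h₂ = 0)
    (hM2 : (f.b : ZMod c) * h₁ + 2 * (f.c : ZMod c) * h₂ = 0) :
    (f.a : ZMod c) * h₁ ^ 2 + (f.b : ZMod c) * h₁ * h₂ + (f.c : ZMod c) * h₂ ^ 2 = 0 := by
  set F : ZMod c := (f.a : ZMod c) * h₁ ^ 2 + (f.b : ZMod c) * h₁ * h₂ + (f.c : ZMod c) * h₂ ^ 2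
    with hF
  have h2F : 2 * F = 0 := by
    rw [hF]; linear_combination h₁ * hM1 + h₂ * hM2
  -- `D h = 0`
  set D : ZMod c := ((f.disc : ℤ) : ZMod c) with hD
  have hDdef : D = (f.b : ZMod c) ^ 2 - 4 * (f.a : ZMod c) * (f.c : ZMod c) := by
    rw [hD, BinQF.disc]; push_cast; ring
  have hDh1 : D * h₁ = 0 := by
    rw [hDdef]; linear_combination (-(2 * (f.c : ZMod c))) * hM1 + (f.b : ZMod c) * hM2
  have hDh2 : D * h₂ = 0 := by
    rw [hDdef]; linear_combination (f.b : ZMod c) * hM1 - 2 * (f.a : ZMod c) * hM2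
  have hD2F : D ^ 2 * F = 0 := by
    rw [hF]
    linear_combination ((f.a : ZMod c) * D * h₁ + (f.b : ZMod c) * D * h₂) * hDh1 +
      ((f.c : ZMod c) * D * h₂) * hDh2
  -- `D² = 2m + 1`
  obtain ⟨m, hm⟩ := hodd.pow (n := 2)
  have hm' : D ^ 2 = 2 * (m : ZMod c) + 1 := by
    rw [hD]; exact_mod_cast congrArg (Int.cast (R := ZMod c)) hm
  linear_combination (-(m : ZMod c)) * h2F + (1 : ZMod c) * hD2F + (-F) * hm'

/-- **The untwisted modulus as a kernel count.** For a unit numerator `a` and a form with odd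
discriminant: `|G(a, c; f, 0)|² = c² · #{h ∈ (ℤ/c)² : M h = 0}`, `M = (2A B; B 2C)`:
`|G|² = Σ_{v,v'} e(a(f(v) − f(v'))/c)`; with `v = v' + h`, `f(v'+h) − f(v') = hᵀMv' + f(h)`, the
sum over `v'` is `c²·[a·Mh = 0]`, and `f(h) ≡ 0` on the kernel (`eval_eq_zero_of_gram_eq_zero`).
[cite: AndrianovZhuravlev2015, Ch. 1 §4.4, proof of Proposition 4.9] -/
theorem norm_sq_binQuadGaussSum_zero_zero_eq_card (f : BinQF) (hodd : Odd f.disc) {a : ZMod c}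
    (ha : IsUnit a) :
    ‖binQuadGaussSum c f a 0 0‖ ^ 2 =
      (c : ℝ) ^ 2 * ((Finset.univ.filter fun h : ZMod c × ZMod c ↦
        2 * (f.a : ZMod c) * h.1 + (f.b : ZMod c) * h.2 = 0 ∧
          (f.b : ZMod c) * h.1 + 2 * (f.c : ZMod c) * h.2 = 0).card : ℝ) := by
  classical
  set α : ZMod c := (f.a : ZMod c) with hα
  set β : ZMod c := (f.b : ZMod c) with hβ
  set γ : ZMod c := (f.c : ZMod c) with hγ
  set Q : ZMod c × ZMod c → ZMod c := fun v ↦ α * v.1 ^ 2 + β * v.1 * v.2 + γ * v.2 ^ 2 with hQ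
  apply Complex.ofReal_injective
  push_cast
  rw [← Complex.mul_conj', binQuadGaussSum_def, map_sum, Finset.sum_mul_sum]
  -- reindex `v = v' + h`
  have hpt : ∀ v' h : ZMod c × ZMod c,
      (ZMod.stdAddChar (a * Q (h + v') + 0 * (h + v').1 + 0 * (h + v').2) : ℂ) *
        (starRingEnd ℂ) (ZMod.stdAddChar (a * Q v' + 0 * v'.1 + 0 * v'.2) : ℂ) =
      (ZMod.stdAddChar (a * Q h) : ℂ) *
        (ZMod.stdAddChar (v'.1 * (a * (2 * α * h.1 + β * h.2)) +
          v'.2 * (a * (β * h.1 + 2 * γ * h.2))) : ℂ) := by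
    intro v' h
    rw [conj_stdAddChar, ← AddChar.map_add_eq_mul, ← AddChar.map_add_eq_mul]
    congr 1
    simp only [hQ, Prod.fst_add, Prod.snd_add]
    ring
  have step1 : ∑ v : ZMod c × ZMod c, ∑ v' : ZMod c × ZMod c,
      (ZMod.stdAddChar (a * Q v + 0 * v.1 + 0 * v.2) : ℂ) *
        (starRingEnd ℂ) (ZMod.stdAddChar (a * Q v' + 0 * v'.1 + 0 * v'.2) : ℂ) =
      ∑ h : ZMod c × ZMod c, (ZMod.stdAddChar (a * Q h) : ℂ) *
        ∑ v' : ZMod c × ZMod c,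
          (ZMod.stdAddChar (v'.1 * (a * (2 * α * h.1 + β * h.2)) +
            v'.2 * (a * (β * h.1 + 2 * γ * h.2))) : ℂ) := by
    calc ∑ v : ZMod c × ZMod c, ∑ v' : ZMod c × ZMod c,
          (ZMod.stdAddChar (a * Q v + 0 * v.1 + 0 * v.2) : ℂ) *
            (starRingEnd ℂ) (ZMod.stdAddChar (a * Q v' + 0 * v'.1 + 0 * v'.2) : ℂ)
        = ∑ v' : ZMod c × ZMod c, ∑ v : ZMod c × ZMod c,
          (ZMod.stdAddChar (a * Q v + 0 * v.1 + 0 * v.2) : ℂ) *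
            (starRingEnd ℂ) (ZMod.stdAddChar (a * Q v' + 0 * v'.1 + 0 * v'.2) : ℂ) :=
          Finset.sum_comm
      _ = ∑ v' : ZMod c × ZMod c, ∑ h : ZMod c × ZMod c, (ZMod.stdAddChar (a * Q h) : ℂ) *
            (ZMod.stdAddChar (v'.1 * (a * (2 * α * h.1 + β * h.2)) +
              v'.2 * (a * (β * h.1 + 2 * γ * h.2))) : ℂ) := by
          refine Finset.sum_congr rfl fun v' _ ↦ ?_
          exact (Fintype.sum_equiv (Equiv.addRight v') _ _ fun h ↦ by
            rw [Equiv.coe_addRight, hpt v' h]).symm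
      _ = ∑ h : ZMod c × ZMod c, ∑ v' : ZMod c × ZMod c, (ZMod.stdAddChar (a * Q h) : ℂ) *
            (ZMod.stdAddChar (v'.1 * (a * (2 * α * h.1 + β * h.2)) +
              v'.2 * (a * (β * h.1 + 2 * γ * h.2))) : ℂ) := Finset.sum_comm
      _ = _ := by simp_rw [Finset.mul_sum]
  simp only [hQ] at step1 ⊢
  rw [step1]
  simp_rw [sum_stdAddChar_linear]
  -- `a` is a unit: the condition is `M h = 0`
  have hcond : ∀ h : ZMod c × ZMod c,
      (a * (2 * α * h.1 + β * h.2) = 0 ∧ a * (β * h.1 + 2 * γ * h.2) = 0) ↔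
        (2 * α * h.1 + β * h.2 = 0 ∧ β * h.1 + 2 * γ * h.2 = 0) := by
    intro h
    rw [ha.mul_right_eq_zero, ha.mul_right_eq_zero]
  simp_rw [hcond]
  rw [← Finset.sum_filter_add_sum_filter_not Finset.univ
    (fun h : ZMod c × ZMod c ↦ 2 * α * h.1 + β * h.2 = 0 ∧ β * h.1 + 2 * γ * h.2 = 0)]
  have hzero : ∑ h ∈ Finset.univ.filter
      (fun h : ZMod c × ZMod c ↦ ¬ (2 * α * h.1 + β * h.2 = 0 ∧ β * h.1 + 2 * γ * h.2 = 0)),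
      (ZMod.stdAddChar (a * (α * h.1 ^ 2 + β * h.1 * h.2 + γ * h.2 ^ 2)) : ℂ) *
        (if 2 * α * h.1 + β * h.2 = 0 ∧ β * h.1 + 2 * γ * h.2 = 0 then (c : ℂ) ^ 2 else 0) = 0 := by
    refine Finset.sum_eq_zero fun h hh ↦ ?_
    rw [Finset.mem_filter] at hh
    rw [if_neg hh.2, mul_zero]
  have hone : ∑ h ∈ Finset.univ.filter
      (fun h : ZMod c × ZMod c ↦ 2 * α * h.1 + β * h.2 = 0 ∧ β * h.1 + 2 * γ * h.2 = 0),
      (ZMod.stdAddChar (a * (α * h.1 ^ 2 + β * h.1 * h.2 + γ * h.2 ^ 2)) : ℂ) *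
        (if 2 * α * h.1 + β * h.2 = 0 ∧ β * h.1 + 2 * γ * h.2 = 0 then (c : ℂ) ^ 2 else 0) =
      ∑ h ∈ Finset.univ.filter
        (fun h : ZMod c × ZMod c ↦ 2 * α * h.1 + β * h.2 = 0 ∧ β * h.1 + 2 * γ * h.2 = 0),
        ((c : ℂ) ^ 2) := by
    refine Finset.sum_congr rfl fun h hh ↦ ?_
    rw [Finset.mem_filter] at hh
    rw [if_pos hh.2, eval_eq_zero_of_gram_eq_zero f hodd h.1 h.2 hh.2.1 hh.2.2, mul_zero,
      AddChar.map_zero_eq_one, one_mul]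
  rw [hzero, hone, add_zero, Finset.sum_const, nsmul_eq_mul]
  ring

/-- **`#ker M = #ker adj(M)` in `(ℤ/n)²`**: `k ↦ (k₂, −k₁)` maps `{k : adj(M)k = 0}` onto
`{h : Mh = 0}` (`adj M = J M Jᵀ` for symmetric `M`, `J = (0 −1; 1 0)`).
[cite: AndrianovZhuravlev2015, Ch. 1 §4.3 (4.13)] -/
theorem card_adj_ker_eq_card_gram_ker (f : BinQF) :
    (Finset.univ.filter fun k : ZMod c × ZMod c ↦
        2 * (f.c : ZMod c) * k.1 - (f.b : ZMod c) * k.2 = 0 ∧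
          -(f.b : ZMod c) * k.1 + 2 * (f.a : ZMod c) * k.2 = 0).card =
      (Finset.univ.filter fun h : ZMod c × ZMod c ↦
        2 * (f.a : ZMod c) * h.1 + (f.b : ZMod c) * h.2 = 0 ∧
          (f.b : ZMod c) * h.1 + 2 * (f.c : ZMod c) * h.2 = 0).card := by
  classical
  refine Finset.card_bij (fun k _ ↦ (k.2, -k.1)) (fun k hk ↦ ?_) (fun k₁ _ k₂ _ h ↦ ?_)
    (fun h hh ↦ ?_)
  · rw [Finset.mem_filter] at hk ⊢
    refine ⟨Finset.mem_univ _, ?_, ?_⟩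
    · linear_combination hk.2.2
    · linear_combination (-1 : ZMod c) * hk.2.1
  · simp only [Prod.mk.injEq, neg_inj] at h
    exact Prod.ext h.2 h.1
  · refine ⟨(-h.2, h.1), ?_, by simp⟩
    rw [Finset.mem_filter] at hh ⊢
    refine ⟨Finset.mem_univ _, ?_, ?_⟩
    · linear_combination (-1 : ZMod c) * hh.2.2
    · linear_combination hh.2.1

end Literature.NumberTheory.ModularForms

end
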